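import Mathlib.Analysis.SpecialFunctions.Complex.LogBounds
import Mathlib.Analysis.Normed.Ring.InfiniteSum
import Literature.NumberTheory.Automorphic.AutomorphicLFunctionProofs
import Literature.NumberTheory.Automorphic.PairLFunctionBaseChange
import Literature.NumberTheory.LFunctions.LandauDirichletSeries
import HarnessLib

/-!
# Jacquet–Shalika's Euler products: (5.3.3) from Lemma (5.2) and Landau's lemma
(companion to `Literature.NumberTheory.Automorphic.AutomorphicLFunctionProofs`)

`AutomorphicLFunctionProofs` reduces the named fact `StandardLFunctionData.multipliable_L` of
`AutomorphicLFunction` (and `multipliable_partialStandardL`, the non-vanishing of `L^S(s, Π)` on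
`re s > 1`, …) to the *single* named input `summable_normSq_trace_satakePow`: the convergence for
`σ > 1` of the series
`f(σ) = ∑_{v ∉ S} ∑_{k ≥ 1} |tr A_v^k|² / (k q_v^{kσ})` — statement (5.3.3)–(5.3.4) in the middle
of the printed proof of Jacquet–Shalika, *On Euler products and the classification of automorphic
representations I*, Amer. J. Math. **103** (1981), Thm. (5.3). This file carries out the printed
proof of (5.3.3)–(5.3.4) itself (loc. cit. p. 556), so that `multipliable_L` comes to rest on the
two *numbered* results of the source that the proof quotes:

* `norm_satakeParameter_le_sqrt` (named fact of `AutomorphicLFunctionProofs`; loc. cit. (5.1.3),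
  from Cor. (2.5) and Remark (2.6)(3): `|μ_{j,v}| ≤ q_v^{1/2}`), and
* `JacquetShalika1981_continuation_partialPairL_conj` (**named fact**, new here; loc. cit.
  Lemma (5.2), p. 554: *`L_S(s, π × π̄)` has an analytic continuation to the half plane
  `Re(s) > 1`*, for `S` finite, containing the ramified places, and large — the Rankin–Selberg
  integral representation of §4 against a mirabolic Eisenstein series; Whittaker models and
  Eisenstein series on `GL_n` are not in Mathlib, so this is recorded, not proved),

everything else being **proved**:

* the local identity `L(s, π_v × π'_v) = det(1 - q_v^{-s} A_v ⊗ A'_v)⁻¹ =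
  exp ∑_{k ≥ 1} tr A_v^k tr A'_v{}^k q_v^{-ks} / k` (loc. cit. p. 556, (1);
  `hasSum_powerSum_mul_powerSum_mul_pow_div`, `exp_neg_sum_log_eq_inv_eval_satakePairPolynomial`,
  and the case `π' = π̄`, where `tr A_v^k tr Ā_v^k = |tr A_v^k|²`, `powerSum_satakeTensor_conj`);
* the regrouping of the double series (5.3.3) over `(k, v)` into a Dirichlet series over `ℕ` with
  non-negative coefficients `a_m = ∑_{q_v^k = m} |tr A_v^k|² / k` (`normSqTraceSeries`; finitely
  many `(k, v)` with `q_v^k = m`, `finite_fiber_jsBase`; `summable_jsCoeff_mul_rpow_neg_iff`: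
  at real points, convergence of (5.3.3) *is* `LSeriesSummable` of the regrouped series);
* its absolute convergence for `re s > 2` from (5.1.3) (`abscissaOfAbsConv_normSqTraceSeries_le_two`)
  and the identity `L_S(s, π × π̄) = exp f(s)` there (loc. cit. (2)–(4);
  `partialPairL_conjFamily_eq_exp_LSeries`: sum over `k`, then over `v`, exponentiate);
* Landau's lemma in the exponential form in which it is used on p. 556
  (`Literature.NumberTheory.LFunctions.Landau.abscissaOfAbsConv_le_of_exp_eq` of `LandauDirichletSeries`, proved there): the
  abscissa of `f` is `≤ 1`, i.e. (5.3.3) converges for `σ > 1`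
  (`summable_normSq_trace_of_continuation`);
* the assembly: `StandardLFunctionData.multipliable_L_of_lemma52` (**proved**:
  `multipliable_L ⇐ (5.1.3) + Lemma (5.2)`; the exceptional set `D.S` of a datum being finite, it
  is simply enlarged to a set `S' ⊇ S₀` of the lemma, and the finitely many factors at `v ∈ S'`
  multiplied back), and, for the Prop-level input of `AutomorphicLFunctionProofs` over arbitrary
  `S`, `summable_normSq_trace_satakePow_of_lemma52` (**proved**: `⇐ (5.1.3) + Lemma (5.2) +`
  the finiteness of the set of ramified places, `eventually_cofinite_isUnramifiedAt` of
  `GLnCuspidalSpectrum`, by adjoining chosen Satake parameters on `S` and comparing series of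
  non-negative terms that differ at finitely many places, `summable_prod_compl_of_subset_union_finite`);
* Thm. (5.3) **for pairs** (the named fact `JacquetShalika1981_multipliable_partialPairL` of
  `PairLFunctionBaseChange`): `JacquetShalika1981_multipliable_partialPairL_of_summable`
  (**proved** from (5.3.3) for `π` and for `π'`, by Cauchy–Schwarz (5.3.5) and the exponential
  (2), loc. cit. p. 556 — `multipliable_inv_satakePairPolynomial`) and
  `JacquetShalika1981_multipliable_partialPairL_of_lemma52`.

Resulting dependency graph of the Jacquet–Shalika facts of the `Automorphic` topic:
`multipliable_L`, `multipliable_partialStandardL`, `absolutelyConvergent_partialStandardL`,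
`L_eq_partialStandardL_mul`, `L^S(s, Π) ≠ 0` (`re s > 1`), `JacquetShalika1981_multipliable_partialPairL`
⇐ `summable_normSq_trace_satakePow` ((5.3.3)–(5.3.4))
⇐ `norm_satakeParameter_le_sqrt` (Cor. (2.5)) + `JacquetShalika1981_continuation_partialPairL_conj`
(Lemma (5.2)) [+ `eventually_cofinite_isUnramifiedAt` (Flath) for arbitrary `S`]; and conversely
`norm_satakeParameter_le_sqrt ⇐ summable_normSq_trace_satakePow` (`AutomorphicLFunctionProofs`).

## References

* H. Jacquet, J. A. Shalika, *On Euler products and the classification of automorphic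
  representations I*, Amer. J. Math. 103 (1981), 499–558 [JacquetShalikaAJM1981]: (5.1) and
  (5.1.1)–(5.1.4) p. 554; Lemma (5.2) p. 554 (proof p. 555); Thm. (5.3) p. 555, proof pp. 555–557
  ((1)–(5) p. 556); Remark (5.4) p. 557; Cor. (2.5) p. 515.
* H. L. Montgomery, R. C. Vaughan, *Multiplicative Number Theory I*, CUP 2007, §1.2, Thm. 1.7
  (Landau's lemma) [MontgomeryVaughan2007] — `Literature.NumberTheory.LFunctions.LandauDirichletSeries`.
* E. C. Titchmarsh, *The Theory of Functions*, 2nd ed., §9.2 (the reference [E.C.T.] of loc. cit.).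
-/

noncomputable section

open scoped MatrixGroups ComplexConjugate ComplexOrder
open NumberField IsDedekindDomain MeasureTheory Polynomial Complex Filter Topology

namespace Literature.NumberTheory.Automorphic

/-! ### Local identities: power sums and logarithms of Euler factors -/

section Local

/-- `‖p_k(α)‖ ≤ (card α) R^k` when all `a ∈ α` have `‖a‖ ≤ R`. [folklore] -/
theorem norm_powerSum_le {α : Multiset ℂ} {R : ℝ} (h : ∀ a ∈ α, ‖a‖ ≤ R) (k : ℕ) :
    ‖(α.map (· ^ k)).sum‖ ≤ Multiset.card α * R ^ k := by
  induction α using Multiset.induction_on with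
  | empty => simp
  | cons a α ih =>
    have ha : ‖a‖ ≤ R := h a (Multiset.mem_cons_self a α)
    have hR : 0 ≤ R := (norm_nonneg a).trans ha
    rw [Multiset.map_cons, Multiset.sum_cons, Multiset.card_cons]
    calc ‖a ^ k + (α.map (· ^ k)).sum‖ ≤ ‖a ^ k‖ + ‖(α.map (· ^ k)).sum‖ := norm_add_le _ _
      _ ≤ R ^ k + Multiset.card α * R ^ k := by
          refine add_le_add ?_ (ih fun b hb => h b (Multiset.mem_cons_of_mem hb))
          rw [norm_pow]
          exact pow_le_pow_left₀ (norm_nonneg a) ha k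
      _ = _ := by push_cast; ring

/-- **Logarithm of an Euler factor.** If `‖c x‖ < 1` for all `c ∈ γ`, then
`∑_{k ≥ 1} p_k(γ) x^k / k = -∑_{c ∈ γ} log (1 - c x)`, where `p_k(γ) = ∑_{c ∈ γ} c^k`
(the series `-log (1 - z) = ∑_{k ≥ 1} z^k / k`, `|z| < 1`, summed over `γ`; Jacquet–Shalika (1981),
p. 556, (1)). Indexed by `k : ℕ` for the exponent `k + 1`. [folklore] -/
theorem hasSum_powerSum_mul_pow_div {γ : Multiset ℂ} {x : ℂ} (h : ∀ c ∈ γ, ‖c * x‖ < 1) :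
    HasSum (fun k : ℕ => (γ.map (· ^ (k + 1))).sum * x ^ (k + 1) / (k + 1))
      (-(γ.map fun c => Complex.log (1 - c * x)).sum) := by
  induction γ using Multiset.induction_on with
  | empty => simp
  | cons c γ ih =>
    have hc : ‖c * x‖ < 1 := h c (Multiset.mem_cons_self c γ)
    have h1 : HasSum (fun k : ℕ => (c * x) ^ (k + 1) / (k + 1)) (-Complex.log (1 - c * x)) := by
      have := (hasSum_nat_add_iff' 1).mpr (Complex.hasSum_taylorSeries_neg_log hc)
      simpa using this
    have h2 := ih fun b hb => h b (Multiset.mem_cons_of_mem hb)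
    convert h1.add h2 using 1
    · funext k
      rw [Multiset.map_cons, Multiset.sum_cons, mul_pow]
      ring
    · simp only [Multiset.map_cons, Multiset.sum_cons, neg_add]

/-- **Exponential form**: under the same hypothesis,
`exp (-∑_{c ∈ γ} log (1 - c x)) = (∏_{c ∈ γ} (1 - c x))⁻¹ = (eulerPolynomial γ)(x)⁻¹`. [folklore] -/
theorem exp_neg_sum_log_eq_inv_eval_eulerPolynomial {γ : Multiset ℂ} {x : ℂ}
    (h : ∀ c ∈ γ, ‖c * x‖ < 1) :
    Complex.exp (-(γ.map fun c => Complex.log (1 - c * x)).sum) =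
      ((eulerPolynomial γ).eval x)⁻¹ := by
  rw [Complex.exp_neg, Complex.exp_multiset_sum, Multiset.map_map, eval_eulerPolynomial]
  refine congrArg Inv.inv (congrArg Multiset.prod (Multiset.map_congr rfl fun c hc => ?_))
  simp only [Function.comp_apply]
  refine Complex.exp_log ?_
  intro h0
  have : ‖c * x‖ = 1 := by
    rw [sub_eq_zero] at h0
    rw [← h0, norm_one]
  exact (h c hc).ne this

/-- `∑ satakeTensor α β = (∑ α) (∑ β)`: `tr (A ⊗ B) = tr A · tr B`. [folklore] -/
theorem sum_satakeTensor (α β : Multiset ℂ) : (satakeTensor α β).sum = α.sum * β.sum := by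
  induction α using Multiset.induction_on with
  | empty => simp
  | cons a α ih =>
    rw [satakeTensor_cons_left, Multiset.sum_add, ih, Multiset.sum_map_mul_left, Multiset.map_id',
      Multiset.sum_cons, add_mul]

/-- Power sums of pair parameters: `p_k(α ⊗ β) = p_k(α) p_k(β)`, i.e.
`tr ((A ⊗ B)^k) = tr A^k · tr B^k`. [folklore] -/
theorem powerSum_satakeTensor (α β : Multiset ℂ) (k : ℕ) :
    ((satakeTensor α β).map (· ^ k)).sum = (α.map (· ^ k)).sum * (β.map (· ^ k)).sum := by
  rw [← satakeTensor_map_pow, sum_satakeTensor]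

/-- Power sums of the complex-conjugate parameters: `p_k(ᾱ) = conj (p_k(α))`. [folklore] -/
theorem powerSum_map_conj (α : Multiset ℂ) (k : ℕ) :
    ((α.map conj).map (· ^ k)).sum = conj ((α.map (· ^ k)).sum) := by
  rw [Multiset.map_map, map_multiset_sum, Multiset.map_map]
  congr 1
  refine Multiset.map_congr rfl fun a _ => ?_
  simp [map_pow]

/-- `p_k(α) p_k(ᾱ) = |p_k(α)|²` (as a complex number): `tr A^k · tr Ā^k = |tr A^k|²`
(Jacquet–Shalika (1981), p. 556, (3)). [folklore] -/
theorem powerSum_satakeTensor_conj (α : Multiset ℂ) (k : ℕ) :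
    ((satakeTensor α (α.map conj)).map (· ^ k)).sum = ((‖(α.map (· ^ k)).sum‖ ^ 2 : ℝ) : ℂ) := by
  rw [powerSum_satakeTensor, powerSum_map_conj, Complex.mul_conj', Complex.ofReal_pow]

/-- Elements of `satakeTensor α β` have norm `≤ R R'` if all `a ∈ α` have `‖a‖ ≤ R` and all
`b ∈ β` have `‖b‖ ≤ R'`. [folklore] -/
theorem norm_le_of_mem_satakeTensor {α β : Multiset ℂ} {R R' : ℝ} (hα : ∀ a ∈ α, ‖a‖ ≤ R)
    (hβ : ∀ b ∈ β, ‖b‖ ≤ R') {c : ℂ} (hc : c ∈ satakeTensor α β) : ‖c‖ ≤ R * R' := by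
  simp only [satakeTensor, Multiset.mem_map, Multiset.mem_product] at hc
  obtain ⟨⟨a, b⟩, ⟨ha, hb⟩, rfl⟩ := hc
  rw [norm_mul]
  exact mul_le_mul (hα a ha) (hβ b hb) (norm_nonneg b) ((norm_nonneg a).trans (hα a ha))

/-- If all `a ∈ α` have `‖a‖ ≤ R`, all `b ∈ β` have `‖b‖ ≤ R'` and `R R' ‖x‖ < 1`, then
`‖c x‖ < 1` for every pair parameter `c = a b ∈ α ⊗ β` (Jacquet–Shalika (1981), p. 555: "the
individual terms in this finite product are of the form `(1 - z)⁻¹` with `|z| < 1`"). [folklore] -/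
theorem norm_mul_lt_one_of_mem_satakeTensor {α β : Multiset ℂ} {R R' : ℝ}
    (hα : ∀ a ∈ α, ‖a‖ ≤ R) (hβ : ∀ b ∈ β, ‖b‖ ≤ R') {x : ℂ} (hx : R * R' * ‖x‖ < 1) {c : ℂ}
    (hc : c ∈ satakeTensor α β) : ‖c * x‖ < 1 := by
  rw [norm_mul]
  exact (mul_le_mul_of_nonneg_right (norm_le_of_mem_satakeTensor hα hβ hc)
    (norm_nonneg x)).trans_lt hx

/-- **The logarithm of `L(s, π_v × π'_v)`** (Jacquet–Shalika (1981), p. 556, (1)): if all `a ∈ α`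
have `‖a‖ ≤ R`, all `b ∈ β` have `‖b‖ ≤ R'` and `R R' ‖x‖ < 1`, then
`∑_{k ≥ 1} p_k(α) p_k(β) x^k / k = -∑_{a ∈ α, b ∈ β} log (1 - a b x)`
(`tr A^k · tr B^k = tr (A ⊗ B)^k`). [folklore] -/
theorem hasSum_powerSum_mul_powerSum_mul_pow_div {α β : Multiset ℂ} {R R' : ℝ}
    (hα : ∀ a ∈ α, ‖a‖ ≤ R) (hβ : ∀ b ∈ β, ‖b‖ ≤ R') {x : ℂ} (hx : R * R' * ‖x‖ < 1) :
    HasSum (fun k : ℕ =>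
        (α.map (· ^ (k + 1))).sum * (β.map (· ^ (k + 1))).sum * x ^ (k + 1) / (k + 1))
      (-((satakeTensor α β).map fun c => Complex.log (1 - c * x)).sum) := by
  have h := hasSum_powerSum_mul_pow_div
    (fun c hc => norm_mul_lt_one_of_mem_satakeTensor hα hβ hx hc)
  simpa only [powerSum_satakeTensor] using h

/-- **`L(s, π_v × π'_v) = exp ∑_{k ≥ 1} tr A_v^k tr A'_v{}^k x^k / k`**, `x = q_v^{-s}`
(Jacquet–Shalika (1981), p. 556, (1)): under the same hypotheses,
`exp (-∑_{a ∈ α, b ∈ β} log (1 - a b x)) = (∏_{a, b} (1 - a b x))⁻¹ = det(1 - x A ⊗ B)⁻¹`.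
[folklore] -/
theorem exp_neg_sum_log_eq_inv_eval_satakePairPolynomial {α β : Multiset ℂ} {R R' : ℝ}
    (hα : ∀ a ∈ α, ‖a‖ ≤ R) (hβ : ∀ b ∈ β, ‖b‖ ≤ R') {x : ℂ} (hx : R * R' * ‖x‖ < 1) :
    Complex.exp (-((satakeTensor α β).map fun c => Complex.log (1 - c * x)).sum) =
      ((satakePairPolynomial α β).eval x)⁻¹ := by
  rw [exp_neg_sum_log_eq_inv_eval_eulerPolynomial
      (fun c hc => norm_mul_lt_one_of_mem_satakeTensor hα hβ hx hc),
    satakePairPolynomial_eq_eulerPolynomial]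

/-- If all `a ∈ α` have `‖a‖ ≤ R` and `R² ‖x‖ < 1`, then `‖c x‖ < 1` for every pair parameter
`c = a ā' ∈ α ⊗ ᾱ`. [folklore] -/
theorem norm_mul_lt_one_of_mem_satakeTensor_conj {α : Multiset ℂ} {R : ℝ}
    (hα : ∀ a ∈ α, ‖a‖ ≤ R) {x : ℂ} (hx : R * R * ‖x‖ < 1) {c : ℂ}
    (hc : c ∈ satakeTensor α (α.map conj)) : ‖c * x‖ < 1 := by
  have hβ : ∀ b ∈ α.map conj, ‖b‖ ≤ R := fun b hb => by
    obtain ⟨a, ha, rfl⟩ := Multiset.mem_map.mp hb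
    rw [Complex.norm_conj]
    exact hα a ha
  have hcR : ‖c‖ ≤ R * R := norm_le_of_mem_satakeTensor hα hβ hc
  rw [norm_mul]
  exact (mul_le_mul_of_nonneg_right hcR (norm_nonneg x)).trans_lt hx

/-- **The logarithm of `L(s, π_v × π̄_v)`** (Jacquet–Shalika (1981), p. 556, (1) with
`π' = π̄`, (3)): if all `a ∈ α` have `‖a‖ ≤ R` and `R² ‖x‖ < 1`, then
`∑_{k ≥ 1} |p_k(α)|² x^k / k = -∑_{a, a' ∈ α} log (1 - a ā' x)`. [folklore] -/
theorem hasSum_normSq_powerSum_mul_pow_div {α : Multiset ℂ} {R : ℝ} (hα : ∀ a ∈ α, ‖a‖ ≤ R)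
    {x : ℂ} (hx : R * R * ‖x‖ < 1) :
    HasSum (fun k : ℕ => ((‖(α.map (· ^ (k + 1))).sum‖ ^ 2 : ℝ) : ℂ) * x ^ (k + 1) / (k + 1))
      (-((satakeTensor α (α.map conj)).map fun c => Complex.log (1 - c * x)).sum) := by
  have h := hasSum_powerSum_mul_pow_div
    (fun c hc => norm_mul_lt_one_of_mem_satakeTensor_conj hα hx hc)
  simpa only [powerSum_satakeTensor_conj] using h

/-- **`L(s, π_v × π̄_v) = exp ∑_{k ≥ 1} |tr A_v^k|² x^k / k`**, `x = q_v^{-s}` (Jacquet–Shalika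
(1981), p. 556, (1)): under the same hypotheses,
`exp (-∑_{a, a' ∈ α} log (1 - a ā' x)) = (∏_{a, a'} (1 - a ā' x))⁻¹ = det(1 - x A ⊗ Ā)⁻¹`.
[folklore] -/
theorem exp_neg_sum_log_eq_inv_eval_satakePairPolynomial_conj {α : Multiset ℂ} {R : ℝ}
    (hα : ∀ a ∈ α, ‖a‖ ≤ R) {x : ℂ} (hx : R * R * ‖x‖ < 1) :
    Complex.exp (-((satakeTensor α (α.map conj)).map fun c => Complex.log (1 - c * x)).sum) =
      ((satakePairPolynomial α (α.map conj)).eval x)⁻¹ := by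
  rw [exp_neg_sum_log_eq_inv_eval_eulerPolynomial
      (fun c hc => norm_mul_lt_one_of_mem_satakeTensor_conj hα hx hc),
    satakePairPolynomial_eq_eulerPolynomial]

end Local

/-! ### Regrouping a non-negative family into a Dirichlet series over `ℕ` -/

section Regroup

variable {ι : Type*}

/-- The **Dirichlet coefficients of a regrouped family**: for `c : ι → ℝ` and `N : ι → ℕ` (with
finite fibres), `fiberCoeff c N m = ∑_{i : N i = m} c i`, so that formally
`∑_i c_i (N i)^{-s} = ∑_m (fiberCoeff c N m) m^{-s}` — the passage from a sum over prime powers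
`q_v^k` to a Dirichlet series over `ℕ` (Jacquet–Shalika (1981), p. 556: (3) "is a Dirichlet series
with non-negative coefficients"). [folklore] -/
def fiberCoeff (c : ι → ℝ) (N : ι → ℕ) (m : ℕ) : ℂ :=
  ((∑' i : N ⁻¹' {m}, c i : ℝ) : ℂ)

/-- The regrouped coefficients of a non-negative family are non-negative. [folklore] -/
theorem fiberCoeff_nonneg {c : ι → ℝ} (hc : 0 ≤ c) (N : ι → ℕ) : 0 ≤ fiberCoeff c N :=
  fun m => zero_le_real.mpr (tsum_nonneg fun i : N ⁻¹' {m} => hc i.1)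

/-- Coefficients at values not attained by `N` vanish. [folklore] -/
theorem fiberCoeff_eq_zero_of_forall_ne {c : ι → ℝ} {N : ι → ℕ} {m : ℕ} (h : ∀ i, N i ≠ m) :
    fiberCoeff c N m = 0 := by
  haveI : IsEmpty (N ⁻¹' {m}) := ⟨fun i => h i.1 i.2⟩
  simp [fiberCoeff]

/-- `∑_{N i = m} c_i (N i)^{-σ} = (∑_{N i = m} c_i) m^{-σ}`. [folklore] -/
theorem tsum_fiber_mul_rpow_neg (c : ι → ℝ) (N : ι → ℕ) (σ : ℝ) (m : ℕ) :
    ∑' i : N ⁻¹' {m}, c i * (N i : ℝ) ^ (-σ) = (∑' i : N ⁻¹' {m}, c i) * (m : ℝ) ^ (-σ) := by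
  rw [← tsum_mul_right]
  exact tsum_congr fun i => by rw [show N i = m from i.2]

/-- The norm of the `m`-th term of the regrouped Dirichlet series at a real point `σ` is the
fibre sum `∑_{N i = m} c_i (N i)^{-σ}` (for `c ≥ 0` and `N` never `0`). [folklore] -/
theorem norm_term_fiberCoeff {c : ι → ℝ} (hc : 0 ≤ c) {N : ι → ℕ} (hN : ∀ i, N i ≠ 0)
    (σ : ℝ) (m : ℕ) :
    ‖LSeries.term (fiberCoeff c N) σ m‖ = ∑' i : N ⁻¹' {m}, c i * (N i : ℝ) ^ (-σ) := by
  rw [LSeries.norm_term_eq, tsum_fiber_mul_rpow_neg]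
  rcases eq_or_ne m 0 with rfl | hm
  · haveI : IsEmpty (N ⁻¹' {0}) := ⟨fun i => hN i.1 i.2⟩
    simp
  · rw [if_neg hm, fiberCoeff, Complex.norm_real,
      Real.norm_of_nonneg (tsum_nonneg fun i : N ⁻¹' {m} => hc i.1), ofReal_re,
      Real.rpow_neg (Nat.cast_nonneg m), div_eq_mul_inv]

/-- **Regrouping, real points.** For `c ≥ 0` and `N : ι → ℕ` with finite fibres and no value
`0`, the family `c_i (N i)^{-σ}` is summable iff the regrouped Dirichlet series
`∑_m (∑_{N i = m} c_i) m^{-σ}` converges (absolutely) at `σ`. [folklore] -/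
theorem summable_mul_rpow_neg_iff {c : ι → ℝ} (hc : 0 ≤ c) {N : ι → ℕ} (hN : ∀ i, N i ≠ 0)
    (hfin : ∀ m, (N ⁻¹' {m}).Finite) (σ : ℝ) :
    (Summable fun i => c i * (N i : ℝ) ^ (-σ)) ↔ LSeriesSummable (fiberCoeff c N) σ := by
  have h0 : (0 : ι → ℝ) ≤ fun i => c i * (N i : ℝ) ^ (-σ) := fun i =>
    mul_nonneg (hc i) (Real.rpow_nonneg (Nat.cast_nonneg _) _)
  rw [summable_partition h0 (s := fun m => N ⁻¹' {m}) fun i => ⟨N i, rfl, fun m hm => hm.symm⟩,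
    LSeriesSummable, ← summable_norm_iff (f := LSeries.term (fiberCoeff c N) σ)]
  simp only [norm_term_fiberCoeff hc hN]
  exact ⟨fun h => h.2, fun h => ⟨fun m => by
    haveI := (hfin m).to_subtype
    exact Summable.of_finite, h⟩⟩

/-- **Regrouping, complex points.** If the family `c_i (N i)^{-s}` is summable (in `ℂ`), the
regrouped Dirichlet series converges at `s` to `∑_i c_i (N i)^{-s}`. [folklore] -/
theorem hasSum_term_fiberCoeff {c : ι → ℝ} {N : ι → ℕ} (hN : ∀ i, N i ≠ 0) {s : ℂ}
    (hs : Summable fun i => (c i : ℂ) * (N i : ℂ) ^ (-s)) :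
    HasSum (LSeries.term (fiberCoeff c N) s) (∑' i, (c i : ℂ) * (N i : ℂ) ^ (-s)) := by
  have h := hs.hasSum.tsum_fiberwise N
  have hfun : (fun m : ℕ => ∑' i : N ⁻¹' {m}, (c i : ℂ) * (N i : ℂ) ^ (-s)) =
      LSeries.term (fiberCoeff c N) s := by
    funext m
    rw [LSeries.term_def₀ (fiberCoeff_eq_zero_of_forall_ne fun i => hN i) s m, fiberCoeff,
      Complex.ofReal_tsum, ← tsum_mul_right]
    exact tsum_congr fun i => by rw [show N i.1 = m from i.2]
  rw [hfun] at h
  exact h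

/-- Hence `LSeries (fiberCoeff c N) s = ∑_i c_i (N i)^{-s}` there. [folklore] -/
theorem LSeries_fiberCoeff_eq {c : ι → ℝ} {N : ι → ℕ} (hN : ∀ i, N i ≠ 0) {s : ℂ}
    (hs : Summable fun i => (c i : ℂ) * (N i : ℂ) ^ (-s)) :
    LSeries (fiberCoeff c N) s = ∑' i, (c i : ℂ) * (N i : ℂ) ^ (-s) :=
  (hasSum_term_fiberCoeff hN hs).tsum_eq

/-- Summability in `ℂ` at `s` from summability of the real family at `re s`
(`‖c_i (N i)^{-s}‖ = c_i (N i)^{-re s}`). [folklore] -/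
theorem summable_ofReal_mul_natCast_cpow {c : ι → ℝ} (hc : 0 ≤ c) {N : ι → ℕ} (hN : ∀ i, N i ≠ 0)
    {s : ℂ} (h : Summable fun i => c i * (N i : ℝ) ^ (-s.re)) :
    Summable fun i => (c i : ℂ) * (N i : ℂ) ^ (-s) := by
  refine Summable.of_norm (h.congr fun i => ?_)
  rw [norm_mul, Complex.norm_real, Real.norm_of_nonneg (hc i),
    norm_natCast_cpow_of_pos (Nat.pos_of_ne_zero (hN i)), neg_re]

end Regroup

/-- `((q ^ k : ℕ) : ℂ) ^ s = ((q : ℂ) ^ s) ^ k` (multiplicativity of `n ↦ n ^ s` on `ℕ`). [folklore] -/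
theorem natCast_pow_cpow (q k : ℕ) (s : ℂ) : ((q ^ k : ℕ) : ℂ) ^ s = ((q : ℂ) ^ s) ^ k := by
  induction k with
  | zero => simp
  | succ k ih => rw [pow_succ, Nat.cast_mul, natCast_mul_natCast_cpow, ih, pow_succ]

/-! ### The series (5.3.3) of Jacquet–Shalika as a Dirichlet series over `ℕ` -/

section Series

variable {K : Type} [Field K] [NumberField K]

/-- The **Satake family of the complex-conjugate representation**: `conjFamily α v = {ā : a ∈ α v}`,
the class `Ā_v` of `π̄_v` when `α v` is the class `A_v` of `π_v` (Jacquet–Shalika (1981), p. 556,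
(3): `tr A_v^n · tr Ā_v^n = |tr A_v^n|²`). [folklore] -/
def conjFamily (α : SatakeFamily K) : SatakeFamily K := fun v => (α v).map conj

omit [NumberField K] in
/-- `conjFamily α v = (α v).map conj` (definitional). [folklore] -/
@[simp]
theorem conjFamily_apply (α : SatakeFamily K) (v : HeightOneSpectrum (𝓞 K)) :
    conjFamily α v = (α v).map conj :=
  rfl

/-- The coefficient `|tr A_v^{k+1}|² / (k + 1) = |p_{k+1}(α v)|² / (k + 1)` of the series (5.3.3)
of Jacquet–Shalika (1981), indexed by `(k, v) ∈ ℕ × {v ∉ S}`. [folklore] -/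
def jsCoeff (S : Set (HeightOneSpectrum (𝓞 K))) (α : SatakeFamily K)
    (i : ℕ × {v : HeightOneSpectrum (𝓞 K) // v ∉ S}) : ℝ :=
  ‖((α i.2.1).map (· ^ (i.1 + 1))).sum‖ ^ 2 / (i.1 + 1)

/-- The base `q_v^{k+1}` of the term `(k, v)` of the series (5.3.3). [folklore] -/
def jsBase (S : Set (HeightOneSpectrum (𝓞 K))) (i : ℕ × {v : HeightOneSpectrum (𝓞 K) // v ∉ S}) :
    ℕ :=
  i.2.1.residueCard ^ (i.1 + 1)

omit [NumberField K] in
/-- The coefficients `|p_{k+1}(α v)|² / (k + 1)` are non-negative. [folklore] -/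
theorem jsCoeff_nonneg (S : Set (HeightOneSpectrum (𝓞 K))) (α : SatakeFamily K) :
    0 ≤ jsCoeff S α := fun i => by
  unfold jsCoeff
  positivity

/-- The bases `q_v^{k+1}` are non-zero. [folklore] -/
theorem jsBase_ne_zero (S : Set (HeightOneSpectrum (𝓞 K)))
    (i : ℕ × {v : HeightOneSpectrum (𝓞 K) // v ∉ S}) : jsBase S i ≠ 0 :=
  pow_ne_zero _ (zero_lt_one.trans i.2.1.one_lt_residueCard).ne'

/-- There are finitely many finite places of bounded norm (Mathlib
`Ideal.finite_setOf_absNorm_le`, pulled back along the injection `v ↦ v.asIdeal`). [folklore] -/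
theorem finite_setOf_residueCard_le (m : ℕ) :
    {v : HeightOneSpectrum (𝓞 K) | v.residueCard ≤ m}.Finite :=
  (Ideal.finite_setOf_absNorm_le (S := 𝓞 K) m).preimage fun _ _ _ _ hvw =>
    HeightOneSpectrum.ext hvw

/-- The fibres of `(k, v) ↦ q_v^{k+1}` are finite. [folklore] -/
theorem finite_fiber_jsBase (S : Set (HeightOneSpectrum (𝓞 K))) (m : ℕ) :
    ((jsBase S) ⁻¹' {m}).Finite := by
  refine ((Set.finite_Iio m).prod ((finite_setOf_residueCard_le (K := K) m).preimage
    Subtype.val_injective.injOn)).subset fun i hi => ?_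
  have hq : 1 < i.2.1.residueCard := i.2.1.one_lt_residueCard
  have hi' : i.2.1.residueCard ^ (i.1 + 1) = m := hi
  refine ⟨?_, ?_⟩
  · show i.1 < m
    calc i.1 < 2 ^ (i.1 + 1) := (Nat.lt_two_pow_self).trans (Nat.pow_lt_pow_right (by norm_num)
          (Nat.lt_succ_self _))
      _ ≤ i.2.1.residueCard ^ (i.1 + 1) := Nat.pow_le_pow_left hq _
      _ = m := hi'
  · show i.2.1.residueCard ≤ m
    rw [← hi']
    exact Nat.le_self_pow (Nat.succ_ne_zero _) _

/-- **The Dirichlet series (5.3.3) over `ℕ`.** The coefficients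
`a_m = ∑_{(k, v) : q_v^k = m, v ∉ S} |tr A_v^k|² / k` of
`f(s) = ∑_{v ∉ S} ∑_{k ≥ 1} |tr A_v^k|² / (k q_v^{ks}) = ∑_m a_m m^{-s}` (Jacquet–Shalika (1981),
p. 556, (3): "a Dirichlet series with non-negative coefficients"), for a Satake family `α` with
`tr A_v^k = p_k(α v)`. [folklore] -/
def normSqTraceSeries (S : Set (HeightOneSpectrum (𝓞 K))) (α : SatakeFamily K) : ℕ → ℂ :=
  fiberCoeff (jsCoeff S α) (jsBase S)

/-- The coefficients of (5.3.3) are non-negative. [folklore] -/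
theorem normSqTraceSeries_nonneg (S : Set (HeightOneSpectrum (𝓞 K))) (α : SatakeFamily K) :
    0 ≤ normSqTraceSeries S α :=
  fiberCoeff_nonneg (jsCoeff_nonneg S α) _

/-- The term `(k, v)` of (5.3.3) at a real point: `c_{k,v} (q_v^{k+1})^{-σ} =
|p_{k+1}(α v)|² / ((k+1) q_v^{(k+1)σ})` (the summand of `summable_normSq_trace_satakePow`).
[folklore] -/
theorem jsCoeff_mul_rpow_neg (S : Set (HeightOneSpectrum (𝓞 K))) (α : SatakeFamily K) (σ : ℝ)
    (i : ℕ × {v : HeightOneSpectrum (𝓞 K) // v ∉ S}) :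
    jsCoeff S α i * (jsBase S i : ℝ) ^ (-σ) =
      ‖((α i.2.1).map (· ^ (i.1 + 1))).sum‖ ^ 2 /
        ((i.1 + 1 : ℝ) * (i.2.1.residueCard : ℝ) ^ ((i.1 + 1 : ℝ) * σ)) := by
  have hq : (0 : ℝ) ≤ i.2.1.residueCard := Nat.cast_nonneg _
  rw [jsCoeff, jsBase, Nat.cast_pow, ← Real.rpow_natCast_mul hq, mul_neg, Real.rpow_neg hq,
    ← div_eq_mul_inv, div_div]
  push_cast
  rfl

/-- The term `(k, v)` of (5.3.3) at a complex point: `c_{k,v} (q_v^{k+1})^{-s} =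
|p_{k+1}(α v)|² x_v^{k+1} / (k + 1)` with `x_v = q_v^{-s}`. [folklore] -/
theorem jsCoeff_mul_cpow_neg (S : Set (HeightOneSpectrum (𝓞 K))) (α : SatakeFamily K) (s : ℂ)
    (i : ℕ × {v : HeightOneSpectrum (𝓞 K) // v ∉ S}) :
    (jsCoeff S α i : ℂ) * (jsBase S i : ℂ) ^ (-s) =
      ((‖((α i.2.1).map (· ^ (i.1 + 1))).sum‖ ^ 2 : ℝ) : ℂ) *
        ((i.2.1.residueCard : ℂ) ^ (-s)) ^ (i.1 + 1) / (i.1 + 1) := by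
  rw [jsCoeff, jsBase, natCast_pow_cpow]
  push_cast
  ring

/-- At real points, convergence of (5.3.3) as a family over `(k, v)` is (absolute) convergence
of the Dirichlet series `normSqTraceSeries` over `ℕ`. [folklore] -/
theorem summable_jsCoeff_mul_rpow_neg_iff (S : Set (HeightOneSpectrum (𝓞 K))) (α : SatakeFamily K)
    (σ : ℝ) : (Summable fun i => jsCoeff S α i * (jsBase S i : ℝ) ^ (-σ)) ↔
      LSeriesSummable (normSqTraceSeries S α) σ :=
  summable_mul_rpow_neg_iff (jsCoeff_nonneg S α) (jsBase_ne_zero S) (finite_fiber_jsBase S) σ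

/-- **Absolute convergence of (5.3.3) for `re s > 2`** from the local bound (5.1.3)
`|μ_{j,v}| ≤ q_v^{1/2}`: `|tr A_v^k|² ≤ n² q_v^k`, so the terms are `≤ n² q_v^{-k(σ-1)}`
(Jacquet–Shalika (1981), p. 556: the series (1) "being absolutely convergent for `Re(s) > 2`").
[folklore] -/
theorem summable_jsCoeff_mul_rpow_neg_of_sqrt {S : Set (HeightOneSpectrum (𝓞 K))}
    {α : SatakeFamily K} {n : ℕ}
    (hb : ∀ v ∉ S, ∀ a ∈ α v, ‖a‖ ≤ Real.sqrt v.residueCard)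
    (hcard : ∀ v ∉ S, Multiset.card (α v) ≤ n) {σ : ℝ} (hσ : 2 < σ) :
    Summable fun i => jsCoeff S α i * (jsBase S i : ℝ) ^ (-σ) := by
  set t : ℝ := σ - 1 with ht
  have ht1 : 1 < t := by linarith
  have ht0 : 0 < t := by linarith
  -- the majorant `n² (2^{-t})^k q_v^{-t}`
  have hgeom : Summable fun k : ℕ => ‖((2 : ℝ) ^ (-t)) ^ k‖ := by
    simp_rw [norm_pow, Real.norm_of_nonneg (Real.rpow_nonneg zero_le_two _)]
    exact summable_geometric_of_lt_one (Real.rpow_nonneg zero_le_two _)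
      (Real.rpow_lt_one_of_one_lt_of_neg one_lt_two (by linarith))
  have hq : Summable fun v : {v : HeightOneSpectrum (𝓞 K) // v ∉ S} =>
      ‖(v.1.residueCard : ℝ) ^ (-t)‖ := by
    simp_rw [Real.norm_of_nonneg (Real.rpow_nonneg (Nat.cast_nonneg _) _)]
    exact (summable_residueCard_rpow_neg ht1).subtype _
  have hmaj : Summable fun i : ℕ × {v : HeightOneSpectrum (𝓞 K) // v ∉ S} =>
      (n : ℝ) ^ 2 * (((2 : ℝ) ^ (-t)) ^ i.1 * (i.2.1.residueCard : ℝ) ^ (-t)) :=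
    (summable_mul_of_summable_norm hgeom hq).mul_left _
  refine Summable.of_nonneg_of_le (fun i => mul_nonneg (jsCoeff_nonneg S α i)
    (Real.rpow_nonneg (Nat.cast_nonneg _) _)) (fun i => ?_) hmaj
  obtain ⟨k, v⟩ := i
  have hq1 : (1 : ℝ) < v.1.residueCard := by exact_mod_cast v.1.one_lt_residueCard
  have hq0 : (0 : ℝ) < v.1.residueCard := zero_lt_one.trans hq1
  have hq2 : (2 : ℝ) ≤ v.1.residueCard := by exact_mod_cast v.1.one_lt_residueCard
  -- `|p_{k+1}|² ≤ n² q^{k+1}`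
  have hp : ‖((α v.1).map (· ^ (k + 1))).sum‖ ^ 2 ≤ (n : ℝ) ^ 2 * (v.1.residueCard : ℝ) ^ (k + 1) := by
    have h1 := norm_powerSum_le (hb v.1 v.2) (k + 1)
    have h2 : (Multiset.card (α v.1) : ℝ) * Real.sqrt v.1.residueCard ^ (k + 1) ≤
        n * Real.sqrt v.1.residueCard ^ (k + 1) :=
      mul_le_mul_of_nonneg_right (by exact_mod_cast hcard v.1 v.2) (by positivity)
    calc ‖((α v.1).map (· ^ (k + 1))).sum‖ ^ 2 ≤ (n * Real.sqrt v.1.residueCard ^ (k + 1)) ^ 2 :=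
          pow_le_pow_left₀ (norm_nonneg _) (h1.trans h2) 2
      _ = (n : ℝ) ^ 2 * (v.1.residueCard : ℝ) ^ (k + 1) := by
          rw [mul_pow, ← pow_mul, mul_comm (k + 1) 2, pow_mul, Real.sq_sqrt hq0.le]
  -- `(q^{k+1})^{-σ} · q^{k+1} = (q^{k+1})^{-t} ≤ q^{-t} (2^{-t})^k`
  have hQ : (0 : ℝ) < (v.1.residueCard : ℝ) ^ (k + 1) := pow_pos hq0 _
  have hbase : ((jsBase S (k, v) : ℕ) : ℝ) = (v.1.residueCard : ℝ) ^ (k + 1) := by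
    simp [jsBase]
  have hpow : (v.1.residueCard : ℝ) ^ (k + 1) * ((v.1.residueCard : ℝ) ^ (k + 1)) ^ (-σ) =
      ((v.1.residueCard : ℝ) ^ (k + 1)) ^ (-t) := by
    rw [show -t = 1 + -σ by rw [ht]; ring, Real.rpow_add hQ, Real.rpow_one]
  have hle : ((v.1.residueCard : ℝ) ^ (k + 1)) ^ (-t) ≤
      ((2 : ℝ) ^ (-t)) ^ k * (v.1.residueCard : ℝ) ^ (-t) := by
    have h3 : (2 : ℝ) ^ k * v.1.residueCard ≤ (v.1.residueCard : ℝ) ^ (k + 1) := by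
      rw [pow_succ]
      exact mul_le_mul_of_nonneg_right (pow_le_pow_left₀ zero_le_two hq2 k) hq0.le
    calc ((v.1.residueCard : ℝ) ^ (k + 1)) ^ (-t) ≤ ((2 : ℝ) ^ k * v.1.residueCard) ^ (-t) :=
          Real.rpow_le_rpow_of_nonpos (by positivity) h3 (by linarith)
      _ = ((2 : ℝ) ^ (-t)) ^ k * (v.1.residueCard : ℝ) ^ (-t) := by
          rw [Real.mul_rpow (by positivity) hq0.le, ← Real.rpow_natCast_mul zero_le_two,
            mul_comm (k : ℝ) (-t), Real.rpow_mul_natCast zero_le_two]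
  calc jsCoeff S α (k, v) * ((jsBase S (k, v) : ℕ) : ℝ) ^ (-σ)
        ≤ (n : ℝ) ^ 2 * (v.1.residueCard : ℝ) ^ (k + 1) * ((v.1.residueCard : ℝ) ^ (k + 1)) ^ (-σ) := by
          rw [hbase]
          refine mul_le_mul_of_nonneg_right ?_ (Real.rpow_nonneg hQ.le _)
          rw [jsCoeff]
          calc ‖((α v.1).map (· ^ (k + 1))).sum‖ ^ 2 / ((k : ℝ) + 1)
                ≤ ‖((α v.1).map (· ^ (k + 1))).sum‖ ^ 2 :=
                  div_le_self (by positivity) (by linarith [(k.cast_nonneg : (0 : ℝ) ≤ k)])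
            _ ≤ _ := hp
    _ = (n : ℝ) ^ 2 * ((v.1.residueCard : ℝ) ^ (k + 1)) ^ (-t) := by rw [mul_assoc, hpow]
    _ ≤ (n : ℝ) ^ 2 * (((2 : ℝ) ^ (-t)) ^ k * (v.1.residueCard : ℝ) ^ (-t)) :=
          mul_le_mul_of_nonneg_left hle (by positivity)

/-- Hence `abscissaOfAbsConv (normSqTraceSeries S α) ≤ 2` under the local bound (5.1.3).
[folklore] -/
theorem abscissaOfAbsConv_normSqTraceSeries_le_two {S : Set (HeightOneSpectrum (𝓞 K))}
    {α : SatakeFamily K} {n : ℕ}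
    (hb : ∀ v ∉ S, ∀ a ∈ α v, ‖a‖ ≤ Real.sqrt v.residueCard)
    (hcard : ∀ v ∉ S, Multiset.card (α v) ≤ n) :
    LSeries.abscissaOfAbsConv (normSqTraceSeries S α) ≤ (2 : ℝ) :=
  LSeries.abscissaOfAbsConv_le_of_forall_lt_LSeriesSummable fun _ hy =>
    (summable_jsCoeff_mul_rpow_neg_iff S α _).mp (summable_jsCoeff_mul_rpow_neg_of_sqrt hb hcard hy)

/-- **`L_S(s, π × π̄) = exp f(s)` for `re s > 2`** (Jacquet–Shalika (1981), p. 556, (2)–(4)):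
under the local bound (5.1.3), for `re s > 2` the Euler product
`∏_{v ∉ S} det(1 - q_v^{-s} A_v ⊗ Ā_v)⁻¹ = partialPairL S α ᾱ s` converges and equals
`exp (∑_m a_m m^{-s})`, `a = normSqTraceSeries S α` the Dirichlet series (5.3.3) over `ℕ`:
the double series `∑_{v ∉ S} ∑_k |tr A_v^k|² q_v^{-ks} / k` converges absolutely for `re s > 2`,
may be summed first over `k` (giving `log L(s, π_v × π̄_v)`, (1)) and then over `v`, and
regrouped over `m = q_v^k`; the exponential of a convergent sum is the (convergent) product of
the exponentials. [folklore] -/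
theorem partialPairL_conjFamily_eq_exp_LSeries {S : Set (HeightOneSpectrum (𝓞 K))}
    {α : SatakeFamily K} {n : ℕ}
    (hb : ∀ v ∉ S, ∀ a ∈ α v, ‖a‖ ≤ Real.sqrt v.residueCard)
    (hcard : ∀ v ∉ S, Multiset.card (α v) ≤ n) {s : ℂ} (hs : 2 < s.re) :
    partialPairL S α (conjFamily α) s = Complex.exp (LSeries (normSqTraceSeries S α) s) := by
  -- the family over `ℕ × {v ∉ S}` is summable in `ℂ` and sums to `LSeries a s`
  have hsumC : Summable fun i : ℕ × {v : HeightOneSpectrum (𝓞 K) // v ∉ S} =>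
      (jsCoeff S α i : ℂ) * (jsBase S i : ℂ) ^ (-s) :=
    summable_ofReal_mul_natCast_cpow (jsCoeff_nonneg S α) (jsBase_ne_zero S)
      (summable_jsCoeff_mul_rpow_neg_of_sqrt hb hcard hs)
  have hL : HasSum (fun i : ℕ × {v : HeightOneSpectrum (𝓞 K) // v ∉ S} =>
      (jsCoeff S α i : ℂ) * (jsBase S i : ℂ) ^ (-s)) (LSeries (normSqTraceSeries S α) s) := by
    rw [normSqTraceSeries, LSeries_fiberCoeff_eq (jsBase_ne_zero S) hsumC]
    exact hsumC.hasSum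
  -- sum first over `k`, for each `v ∉ S`
  set g : {v : HeightOneSpectrum (𝓞 K) // v ∉ S} → ℂ := fun v =>
    -((satakeTensor (α v.1) ((α v.1).map conj)).map fun c =>
      Complex.log (1 - c * ((v.1.residueCard : ℂ) ^ (-s)))).sum with hg
  have hx : ∀ v : {v : HeightOneSpectrum (𝓞 K) // v ∉ S},
      Real.sqrt v.1.residueCard * Real.sqrt v.1.residueCard * ‖(v.1.residueCard : ℂ) ^ (-s)‖ < 1 := by
    intro v
    have hq1 : (1 : ℝ) < v.1.residueCard := by exact_mod_cast v.1.one_lt_residueCard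
    have hq0 : (0 : ℝ) < v.1.residueCard := zero_lt_one.trans hq1
    rw [Real.mul_self_sqrt hq0.le, norm_natCast_cpow_of_pos (zero_lt_one.trans
      v.1.one_lt_residueCard), neg_re]
    calc (v.1.residueCard : ℝ) * (v.1.residueCard : ℝ) ^ (-s.re)
          = (v.1.residueCard : ℝ) ^ (1 + -s.re) := by rw [Real.rpow_add hq0, Real.rpow_one]
      _ < 1 := Real.rpow_lt_one_of_one_lt_of_neg hq1 (by linarith)
  have hfib : ∀ v : {v : HeightOneSpectrum (𝓞 K) // v ∉ S},
      HasSum (fun k : ℕ => (jsCoeff S α (k, v) : ℂ) * (jsBase S (k, v) : ℂ) ^ (-s)) (g v) := by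
    intro v
    have h := hasSum_normSq_powerSum_mul_pow_div (hb v.1 v.2) (hx v)
    refine (h.congr_fun fun k => ?_)
    rw [jsCoeff_mul_cpow_neg]
  have hG : HasSum g (LSeries (normSqTraceSeries S α) s) :=
    HasSum.prod_fiberwise
      ((Equiv.prodComm {v : HeightOneSpectrum (𝓞 K) // v ∉ S} ℕ).hasSum_iff.mpr hL) hfib
  -- exponentiate
  have hP := hG.cexp
  have hfun : (cexp ∘ g) = fun v : {v : HeightOneSpectrum (𝓞 K) // v ∉ S} =>
      ((satakePairPolynomial (α v.1) (conjFamily α v.1)).eval ((v.1.residueCard : ℂ) ^ (-s)))⁻¹ := by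
    funext v
    simp only [Function.comp_apply, hg, conjFamily_apply]
    exact exp_neg_sum_log_eq_inv_eval_satakePairPolynomial_conj (hb v.1 v.2) (hx v)
  rw [hfun] at hP
  exact hP.tprod_eq

/-- **Landau's lemma applied to (5.3.3)** (Jacquet–Shalika (1981), p. 556, the paragraph after
(4)): under the local bound (5.1.3), if `L_S(s, π × π̄) = partialPairL S α ᾱ` (on some right
half-plane `re s > x₀`) extends to a function `F` holomorphic on `re s > 1`, then the series
(5.3.3) `∑_{v ∉ S} ∑_k |tr A_v^k|² / (k q_v^{kσ})` converges for every `σ > 1`: its Dirichlet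
series over `ℕ` has non-negative coefficients, abscissa `≤ 2`, and exponential `L_S(s, π × π̄)`
on `re s > max(x₀, 2)`, so by Landau's lemma (exponential form,
`Literature.NumberTheory.LFunctions.Landau.abscissaOfAbsConv_le_of_exp_eq`) its abscissa is `≤ 1`. [folklore] -/
theorem summable_jsCoeff_mul_rpow_neg_of_continuation {S : Set (HeightOneSpectrum (𝓞 K))}
    {α : SatakeFamily K} {n : ℕ}
    (hb : ∀ v ∉ S, ∀ a ∈ α v, ‖a‖ ≤ Real.sqrt v.residueCard)
    (hcard : ∀ v ∉ S, Multiset.card (α v) ≤ n) {F : ℂ → ℂ} {x₀ : ℝ}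
    (hF : DifferentiableOn ℂ F {s : ℂ | 1 < s.re})
    (hFeq : ∀ s : ℂ, x₀ < s.re → F s = partialPairL S α (conjFamily α) s)
    {σ : ℝ} (hσ : 1 < σ) :
    Summable fun i => jsCoeff S α i * (jsBase S i : ℝ) ^ (-σ) := by
  have h2 := abscissaOfAbsConv_normSqTraceSeries_le_two hb hcard
  have hax : LSeries.abscissaOfAbsConv (normSqTraceSeries S α) ≤ (max x₀ 2 : ℝ) :=
    h2.trans (by exact_mod_cast le_max_right _ _)
  have h1 : LSeries.abscissaOfAbsConv (normSqTraceSeries S α) ≤ (1 : ℝ) :=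
    Literature.NumberTheory.LFunctions.Landau.abscissaOfAbsConv_le_of_exp_eq (normSqTraceSeries_nonneg S α) hax hF
      fun s hs => by
        rw [hFeq s ((le_max_left _ _).trans_lt hs),
          partialPairL_conjFamily_eq_exp_LSeries hb hcard ((le_max_right _ _).trans_lt hs)]
  have hsum : LSeriesSummable (normSqTraceSeries S α) σ := by
    refine LSeriesSummable_of_abscissaOfAbsConv_lt_re (h1.trans_lt ?_)
    rw [ofReal_re]
    exact_mod_cast hσ
  exact (summable_jsCoeff_mul_rpow_neg_iff S α σ).mpr hsum

/-- The same conclusion in the shape of `summable_normSq_trace_satakePow`: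
`∑_{(k, v)} |p_{k+1}(α v)|² / ((k+1) q_v^{(k+1)σ}) < ∞` for `σ > 1`. [folklore] -/
theorem summable_normSq_trace_of_continuation {S : Set (HeightOneSpectrum (𝓞 K))}
    {α : SatakeFamily K} {n : ℕ}
    (hb : ∀ v ∉ S, ∀ a ∈ α v, ‖a‖ ≤ Real.sqrt v.residueCard)
    (hcard : ∀ v ∉ S, Multiset.card (α v) ≤ n) {F : ℂ → ℂ} {x₀ : ℝ}
    (hF : DifferentiableOn ℂ F {s : ℂ | 1 < s.re})
    (hFeq : ∀ s : ℂ, x₀ < s.re → F s = partialPairL S α (conjFamily α) s)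
    {σ : ℝ} (hσ : 1 < σ) :
    Summable fun kv : ℕ × {v : HeightOneSpectrum (𝓞 K) // v ∉ S} =>
      ‖((α kv.2.1).map (· ^ (kv.1 + 1))).sum‖ ^ 2 /
        ((kv.1 + 1 : ℝ) * (kv.2.1.residueCard : ℝ) ^ ((kv.1 + 1 : ℝ) * σ)) :=
  (summable_jsCoeff_mul_rpow_neg_of_continuation hb hcard hF hFeq hσ).congr fun i =>
    jsCoeff_mul_rpow_neg S α σ i

/-! ### From (5.3.3) to the Euler product, for one Satake family -/

/-- **Thm. (5.3), case `π' = 1`, for one Satake family** (the estimate of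
`absolutelyConvergent_partialStandardL_of_JS`, pointwise): the bound (5.1.3) off `S` and the
convergence of (5.3.3) at `σ = re s > 1` give `∑_{v ∉ S} ‖L(s, Π_v) - 1‖ < ∞`. [folklore] -/
theorem summable_norm_inv_eulerFactor_sub_one {S : Set (HeightOneSpectrum (𝓞 K))}
    {α : SatakeFamily K} {n : ℕ}
    (hb : ∀ v ∉ S, ∀ a ∈ α v, ‖a‖ ≤ Real.sqrt v.residueCard)
    (hcard : ∀ v ∉ S, Multiset.card (α v) ≤ n) {s : ℂ} (hs : 1 < s.re)
    (hsum : Summable fun kv : ℕ × {v : HeightOneSpectrum (𝓞 K) // v ∉ S} =>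
      ‖((α kv.2.1).map (· ^ (kv.1 + 1))).sum‖ ^ 2 /
        ((kv.1 + 1 : ℝ) * (kv.2.1.residueCard : ℝ) ^ ((kv.1 + 1 : ℝ) * s.re))) :
    Summable fun v : {v : HeightOneSpectrum (𝓞 K) // v ∉ S} =>
      ‖((eulerPolynomial (α v.1)).eval ((v.1.residueCard : ℂ) ^ (-s)))⁻¹ - 1‖ := by
  set σ := s.re with hσ
  let b : {v : HeightOneSpectrum (𝓞 K) // v ∉ S} → ℝ := fun v =>
    ‖(α v.1).sum‖ ^ 2 * (v.1.residueCard : ℝ) ^ (-σ) + (v.1.residueCard : ℝ) ^ (-σ) +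
      4 ^ n * (v.1.residueCard : ℝ) ^ (1 - 2 * σ)
  have hb' : Summable b := by
    refine ((?_ : Summable _).add ?_).add ?_
    · refine (hsum.prod_factor 0).congr fun v => ?_
      have hq0 : (0 : ℝ) ≤ v.1.residueCard := Nat.cast_nonneg _
      simp [Real.rpow_neg hq0, div_eq_mul_inv]
    · exact (summable_residueCard_rpow_neg hs).subtype _
    · refine (((summable_residueCard_rpow_neg (K := K) (σ := 2 * σ - 1) (by linarith)).subtype
        _).mul_left (4 ^ n)).congr fun v => ?_
      simp [neg_sub]
  refine summable_norm_inv_sub_one hb' fun v => ?_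
  have h := norm_eval_eulerPolynomial_sub_one_le_of_sqrt v.1.one_lt_residueCard (hb v.1 v.2)
    (s := s) (by linarith)
  refine h.trans ?_
  have h4 : (4 : ℝ) ^ Multiset.card (α v.1) ≤ 4 ^ n :=
    pow_le_pow_right₀ (by norm_num) (hcard v.1 v.2)
  have hq0 : (0 : ℝ) ≤ (v.1.residueCard : ℝ) ^ (1 - 2 * σ) := Real.rpow_nonneg (Nat.cast_nonneg _) _
  show _ ≤ ‖(α v.1).sum‖ ^ 2 * (v.1.residueCard : ℝ) ^ (-σ) + (v.1.residueCard : ℝ) ^ (-σ) +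
      4 ^ n * (v.1.residueCard : ℝ) ^ (1 - 2 * σ)
  nlinarith [mul_le_mul_of_nonneg_right h4 hq0]

/-- Hence the partial Euler product of the family is multipliable at `s`. [folklore] -/
theorem multipliable_inv_eulerFactor {S : Set (HeightOneSpectrum (𝓞 K))}
    {α : SatakeFamily K} {n : ℕ}
    (hb : ∀ v ∉ S, ∀ a ∈ α v, ‖a‖ ≤ Real.sqrt v.residueCard)
    (hcard : ∀ v ∉ S, Multiset.card (α v) ≤ n) {s : ℂ} (hs : 1 < s.re)
    (hsum : Summable fun kv : ℕ × {v : HeightOneSpectrum (𝓞 K) // v ∉ S} =>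
      ‖((α kv.2.1).map (· ^ (kv.1 + 1))).sum‖ ^ 2 /
        ((kv.1 + 1 : ℝ) * (kv.2.1.residueCard : ℝ) ^ ((kv.1 + 1 : ℝ) * s.re))) :
    Multipliable fun v : {v : HeightOneSpectrum (𝓞 K) // v ∉ S} =>
      ((eulerPolynomial (α v.1)).eval ((v.1.residueCard : ℂ) ^ (-s)))⁻¹ := by
  refine (multipliable_one_add_of_summable
    (summable_norm_inv_eulerFactor_sub_one hb hcard hs hsum)).congr fun v => ?_
  simp only [add_sub_cancel]

end Series

/-! ### Lemma (5.2) as a named fact, and the assembly -/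

section Cuspidal

variable {n : ℕ} {K : Type} [Field K] [NumberField K]
  {μ : Measure (AdelicGroupData.gl n K).automorphicQuotient}
  [(AdelicGroupData.gl n K).IsAutomorphicMeasure μ]

/-- **Jacquet–Shalika (1981), Lemma (5.2)** (as printed, p. 554): *Let `π` be an irreducible
unitary cuspidal representation of `G_r(𝔸)`. Then the function `L_S(s, π × π̄)` has an analytic
continuation to the half plane `Re(s) > 1`.* Here (loc. cit. (5.1), p. 554) `S` is a finite set of
places containing the infinite places and the finite places where `π` is ramified, assumed
"large enough" (so that the additive character `ψ_v` is unramified for `v ∉ S`);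
`L(s, π_v × π'_v) = det(1 - q_v^{-s} A_v ⊗ A'_v)⁻¹` for `v ∉ S` ((5.1.1)), with `A_v` the Satake
class of `π_v` and `Ā_v` (the complex-conjugate class, p. 556, (3)) that of `π̄_v`; and
`L_S(s, π × π') = ∏_{v ∉ S} L(s, π_v × π'_v)` "converges absolutely to an analytic function in some
right half-plane" ((5.1.4)). The printed proof is the Rankin–Selberg integral representation
`Ψ(s, W', W, Φ) = A(s) L_S(s, π × π̄)` of §4 against a mirabolic Eisenstein series, holomorphic on
`Re(s) > 1` by (4.6), with `A(s₀) ≠ 0` for a suitable choice of data (p. 555).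

Stated over the tree's honest objects: for every cuspidal `Π` (cuspidal representations in
`L²(GL_n(K) A_G \ GL_n(𝔸_K))` are unitary, outline D10) there is a finite set `S₀` of finite
places ("`S` large") such that for every finite `S ⊇ S₀` and every Satake family `α` of `Π` away
from `S` (`IsSatakeFamilyOf`, which forces `S` to contain the ramified places), the partial Euler
product `partialPairL S α (conjFamily α) s = ∏_{v ∉ S} ∏_{a, a' ∈ α v} (1 - a ā' q_v^{-s})⁻¹`
agrees on some right half-plane `re s > x₀` with a function holomorphic on `re s > 1`. (The
complex conjugates of the Hecke–Satake parameters of `π_v` are those of `π̄_v`, the spherical Hecke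
operators being real; and should the tree's left/right convention make `α v` the class of the
contragredient `π̃_v ≅ π̄_v` (unitarity) rather than of `π_v`, the pair family `{a ā'}` is the same
multiset, so the statement is insensitive to the normalisation.)
[cite: JacquetShalikaAJM1981, Lemma (5.2), (5.1), p. 554] -/
def JacquetShalika1981_continuation_partialPairL_conj : Prop :=
  ∀ (P : CuspidalAutomorphicRepGL n K μ), ∃ S₀ : Finset (HeightOneSpectrum (𝓞 K)),
    ∀ ⦃S : Finset (HeightOneSpectrum (𝓞 K))⦄ ⦃α : SatakeFamily K⦄, S₀ ⊆ S →
      IsSatakeFamilyOf P ↑S α →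
        ∃ (F : ℂ → ℂ) (x₀ : ℝ), DifferentiableOn ℂ F {s : ℂ | 1 < s.re} ∧
          ∀ s : ℂ, x₀ < s.re → F s = partialPairL ↑S α (conjFamily α) s

/-- **Summability over `ℕ × {v ∉ S}` from summability off a larger set plus finitely many
places.** For `g ≥ 0` on `ℕ × X`: if `g` is summable over `ℕ × {v ∉ T}` with `T ⊆ S ∪ F`,
`F` finite, and `∑_k g(k, v) < ∞` for each `v ∈ F`, then `g` is summable over `ℕ × {v ∉ S}`.
[folklore] -/
theorem summable_prod_compl_of_subset_union_finite {X : Type*} {g : ℕ × X → ℝ} (hg : 0 ≤ g)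
    {S T F : Set X} (hF : F.Finite) (hT : T ⊆ S ∪ F)
    (hsum : Summable fun i : ℕ × {v : X // v ∉ T} => g (i.1, i.2.1))
    (hfib : ∀ v ∈ F, Summable fun k : ℕ => g (k, v)) :
    Summable fun i : ℕ × {v : X // v ∉ S} => g (i.1, i.2.1) := by
  rw [← summable_subtype_and_compl (s := {i : ℕ × {v : X // v ∉ S} | i.2.1 ∈ F})]
  constructor
  · -- the part over `v ∈ F`: embeds into `ℕ × F`
    have hF' : Summable fun p : F × ℕ => g (p.2, p.1.1) := by
      refine (summable_prod_of_nonneg (f := fun p : F × ℕ => g (p.2, p.1.1)) fun p => hg _).mpr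
        ⟨fun v => hfib v.1 v.2, ?_⟩
      haveI := hF.to_subtype
      exact Summable.of_finite
    have h1 : Summable fun p : ℕ × F => g (p.1, p.2.1) :=
      (Equiv.prodComm ℕ F).summable_iff.mpr hF'
    let ι : {i : ℕ × {v : X // v ∉ S} // i ∈ {i : ℕ × {v : X // v ∉ S} | i.2.1 ∈ F}} → ℕ × F :=
      fun i => (i.1.1, ⟨i.1.2.1, i.2⟩)
    have hι : Function.Injective ι := by
      rintro ⟨⟨k, v⟩, hv⟩ ⟨⟨k', v'⟩, hv'⟩ h
      simp only [ι, Prod.mk.injEq, Subtype.mk.injEq] at h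
      obtain ⟨rfl, h2⟩ := h
      have : v = v' := Subtype.ext h2
      subst this
      rfl
    exact h1.comp_injective hι
  · -- the part over `v ∉ F`: embeds into `ℕ × {v ∉ T}`
    let κ : {i : ℕ × {v : X // v ∉ S} // i ∈ {i : ℕ × {v : X // v ∉ S} | i.2.1 ∈ F}ᶜ} →
        ℕ × {v : X // v ∉ T} :=
      fun i => (i.1.1, ⟨i.1.2.1, fun hT' => (hT hT').elim i.1.2.2 i.2⟩)
    have hκ : Function.Injective κ := by
      rintro ⟨⟨k, v⟩, hv⟩ ⟨⟨k', v'⟩, hv'⟩ h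
      simp only [κ, Prod.mk.injEq, Subtype.mk.injEq] at h
      obtain ⟨rfl, h2⟩ := h
      have : v = v' := Subtype.ext h2
      subst this
      rfl
    exact hsum.comp_injective hκ

/-- A single unramified place contributes a convergent series to (5.3.3) for `σ > 1`, by the
bound (5.1.3) alone: `|p_{k+1}(α)|² / ((k+1) q^{(k+1)σ}) ≤ n² q^{(k+1)(1-σ)}`, a geometric
series (Jacquet–Shalika (1981), p. 556: (1) converges absolutely; used for the finitely many
places by which `S` is enlarged). [folklore] -/
theorem summable_normSq_powerSum_div_of_sqrt {α : Multiset ℂ} {q n : ℕ} (hq : 1 < q)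
    (hb : ∀ a ∈ α, ‖a‖ ≤ Real.sqrt q) (hcard : Multiset.card α ≤ n) {σ : ℝ} (hσ : 1 < σ) :
    Summable fun k : ℕ =>
      ‖(α.map (· ^ (k + 1))).sum‖ ^ 2 / ((k + 1 : ℝ) * (q : ℝ) ^ ((k + 1 : ℝ) * σ)) := by
  have hq1 : (1 : ℝ) < q := by exact_mod_cast hq
  have hq0 : (0 : ℝ) < q := zero_lt_one.trans hq1
  set r : ℝ := (q : ℝ) ^ (1 - σ) with hr
  have hr0 : 0 ≤ r := Real.rpow_nonneg hq0.le _
  have hr1 : r < 1 := Real.rpow_lt_one_of_one_lt_of_neg hq1 (by linarith)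
  have hmaj : Summable fun k : ℕ => (n : ℝ) ^ 2 * r ^ (k + 1) :=
    ((summable_geometric_of_lt_one hr0 hr1).mul_left ((n : ℝ) ^ 2 * r)).congr fun k => by ring
  refine Summable.of_nonneg_of_le (fun k => by positivity) (fun k => ?_) hmaj
  have hp : ‖(α.map (· ^ (k + 1))).sum‖ ^ 2 ≤ (n : ℝ) ^ 2 * (q : ℝ) ^ (k + 1) := by
    have h1 := norm_powerSum_le hb (k + 1)
    have h2 : (Multiset.card α : ℝ) * Real.sqrt q ^ (k + 1) ≤ n * Real.sqrt q ^ (k + 1) :=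
      mul_le_mul_of_nonneg_right (by exact_mod_cast hcard) (by positivity)
    calc ‖(α.map (· ^ (k + 1))).sum‖ ^ 2 ≤ (n * Real.sqrt q ^ (k + 1)) ^ 2 :=
          pow_le_pow_left₀ (norm_nonneg _) (h1.trans h2) 2
      _ = (n : ℝ) ^ 2 * (q : ℝ) ^ (k + 1) := by
          rw [mul_pow, ← pow_mul, mul_comm (k + 1) 2, pow_mul, Real.sq_sqrt hq0.le]
  have hden : (0 : ℝ) < (k + 1 : ℝ) * (q : ℝ) ^ ((k + 1 : ℝ) * σ) := by positivity
  have hk1 : (1 : ℝ) ≤ k + 1 := by linarith [(k.cast_nonneg : (0 : ℝ) ≤ k)]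
  have hQ : (q : ℝ) ^ (k + 1) / (q : ℝ) ^ ((k + 1 : ℝ) * σ) = r ^ (k + 1) := by
    rw [hr, ← Real.rpow_natCast, ← Real.rpow_sub hq0, ← Real.rpow_mul_natCast hq0.le]
    congr 1
    push_cast
    ring
  calc ‖(α.map (· ^ (k + 1))).sum‖ ^ 2 / ((k + 1 : ℝ) * (q : ℝ) ^ ((k + 1 : ℝ) * σ))
        ≤ (n : ℝ) ^ 2 * (q : ℝ) ^ (k + 1) / ((k + 1 : ℝ) * (q : ℝ) ^ ((k + 1 : ℝ) * σ)) :=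
          div_le_div_of_nonneg_right hp hden.le
    _ ≤ (n : ℝ) ^ 2 * (q : ℝ) ^ (k + 1) / (1 * (q : ℝ) ^ ((k + 1 : ℝ) * σ)) := by
          gcongr
    _ = (n : ℝ) ^ 2 * r ^ (k + 1) := by rw [one_mul, mul_div_assoc, hQ]

/-- **(5.3.3)–(5.3.4) from Lemma (5.2), for the finite exceptional sets of the lemma.** For a
cuspidal `Π`, a finite `S ⊇ S₀` and a Satake family `α` of `Π` off `S`, the bound (5.1.3)
(`norm_satakeParameter_le_sqrt`) and Lemma (5.2)
(`JacquetShalika1981_continuation_partialPairL_conj`) give the convergence of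
`∑_{v ∉ S} ∑_k |tr A_v^k|² / (k q_v^{kσ})` for `σ > 1` (Jacquet–Shalika (1981), p. 556, via
Landau's lemma: `summable_normSq_trace_of_continuation`). [folklore] -/
theorem summable_normSq_trace_finset_of_lemma52 (h₁ : norm_satakeParameter_le_sqrt (μ := μ))
    (h₅₂ : JacquetShalika1981_continuation_partialPairL_conj (μ := μ))
    (P : CuspidalAutomorphicRepGL n K μ) :
    ∃ S₀ : Finset (HeightOneSpectrum (𝓞 K)), ∀ ⦃S : Finset (HeightOneSpectrum (𝓞 K))⦄
      ⦃α : SatakeFamily K⦄, S₀ ⊆ S → IsSatakeFamilyOf P ↑S α → ∀ ⦃σ : ℝ⦄, 1 < σ →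
        Summable fun kv : ℕ × {v : HeightOneSpectrum (𝓞 K) // v ∉ (↑S : Set _)} =>
          ‖((α kv.2.1).map (· ^ (kv.1 + 1))).sum‖ ^ 2 /
            ((kv.1 + 1 : ℝ) * (kv.2.1.residueCard : ℝ) ^ ((kv.1 + 1 : ℝ) * σ)) := by
  obtain ⟨S₀, hS₀⟩ := h₅₂ P
  refine ⟨S₀, fun S α hS hα σ hσ => ?_⟩
  obtain ⟨F, x₀, hF, hFeq⟩ := hS₀ hS hα
  exact summable_normSq_trace_of_continuation (n := n) (fun v hv a ha => h₁ P hα hv ha)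
    (fun v hv => (hα.card_eq hv).le) hF hFeq hσ

/-- **`summable_normSq_trace_satakePow` from Lemma (5.2)** (together with the bound (5.1.3) and
the finiteness of the set of ramified places, `eventually_cofinite_isUnramifiedAt` of
`GLnCuspidalSpectrum`, Flath (1979) / Borel–Jacquet (1979), §4.6): the named input (5.3.3)–(5.3.4)
of `AutomorphicLFunctionProofs`, for an arbitrary set `S` off which `Π` has Satake parameters,
follows from its case `S` finite and large (`summable_normSq_trace_finset_of_lemma52`): enlarge
the family `α` by chosen Satake parameters at the unramified places of `S`, apply the finite case
off `S' = {ramified places} ∪ S₀`, restrict the resulting convergent series of non-negative terms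
to `v ∉ S ∪ S'`, and add the finitely many places of `S' ∖ S`, each contributing a series
convergent for `σ > 1` by (5.1.3) (`summable_normSq_powerSum_div_of_sqrt`). [folklore] -/
theorem summable_normSq_trace_satakePow_of_lemma52 (h₁ : norm_satakeParameter_le_sqrt (μ := μ))
    (h₅₂ : JacquetShalika1981_continuation_partialPairL_conj (μ := μ))
    (hfl : eventually_cofinite_isUnramifiedAt (μ := μ)) :
    summable_normSq_trace_satakePow (μ := μ) := by
  classical
  intro P S α hα σ hσ
  obtain ⟨R, β, hR, hβ⟩ := exists_isSatakeFamilyOf_of_eventually_cofinite hfl P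
  obtain ⟨S₀, hS₀⟩ := summable_normSq_trace_finset_of_lemma52 h₁ h₅₂ P
  set S' : Finset (HeightOneSpectrum (𝓞 K)) := R ∪ S₀ with hS'
  -- the enlarged family: `α` off `S`, the chosen parameters `β` on `S`
  let α' : SatakeFamily K := fun v => if v ∈ S then β v else α v
  have hα'S : ∀ v ∉ S, α' v = α v := fun v hv => if_neg hv
  have hα' : IsSatakeFamilyOf P ↑S' α' := by
    intro v hv
    have hvR : v ∉ (↑R : Set _) := fun h => hv (by
      rw [hS', Finset.coe_union]; exact Or.inl h)
    by_cases hvS : v ∈ S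
    · simp only [α', if_pos hvS]
      exact hβ v hvR
    · simp only [α', if_neg hvS]
      exact hα v hvS
  have hsum' := hS₀ (Finset.subset_union_right) hα' hσ
  -- transfer from `(S', α')` to `(S, α)`
  let g : ℕ × HeightOneSpectrum (𝓞 K) → ℝ := fun kv =>
    ‖((α' kv.2).map (· ^ (kv.1 + 1))).sum‖ ^ 2 /
      ((kv.1 + 1 : ℝ) * (kv.2.residueCard : ℝ) ^ ((kv.1 + 1 : ℝ) * σ))
  have hg : 0 ≤ g := fun kv => by positivity
  have hT : (↑S' : Set (HeightOneSpectrum (𝓞 K))) ⊆ S ∪ (↑S' \ S) := by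
    rw [Set.union_sdiff_self]
    exact Set.subset_union_right
  have hfib : ∀ v ∈ (↑S' : Set (HeightOneSpectrum (𝓞 K))) \ S, Summable fun k : ℕ => g (k, v) := by
    rintro v ⟨-, hvS⟩
    simp only [g, hα'S v hvS]
    exact summable_normSq_powerSum_div_of_sqrt v.one_lt_residueCard
      (fun a ha => h₁ P hα hvS ha) (hα.card_eq hvS).le hσ
  have hmain : Summable fun i : ℕ × {v : HeightOneSpectrum (𝓞 K) // v ∉ S} => g (i.1, i.2.1) :=
    summable_prod_compl_of_subset_union_finite hg (S'.finite_toSet.subset Set.sdiff_subset) hT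
      (by exact hsum') hfib
  refine hmain.congr fun i => ?_
  simp only [g, hα'S i.2.1 i.2.2]

/-- **`multipliable_L` from Lemma (5.2) and (5.1.3)** — the architecture of the printed proof of
Jacquet–Shalika's Thm. (5.3) (case `p = 1`, `π' = 1` of Remark (5.4)) over the tree's honest
definitions, with the two *numbered* results of the source as the only named inputs: the local
bound `|μ_{j,v}| ≤ q_v^{1/2}` (Cor. (2.5) / (5.1.3), `norm_satakeParameter_le_sqrt`) and the
continuation of `L_S(s, π × π̄)` to `re s > 1` (Lemma (5.2),
`JacquetShalika1981_continuation_partialPairL_conj`); Landau's lemma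
(`Literature.NumberTheory.LFunctions.Landau.abscissaOfAbsConv_le_of_exp_eq`), the passage (5.3.3) ⇒ absolute convergence
(`summable_norm_inv_eulerFactor_sub_one`) and the bookkeeping are proved. For
`D : StandardLFunctionData Π` the exceptional set `D.S` is finite, so no finiteness statement on
ramification is needed: enlarge `D.S` to `S' = D.S ∪ S₀`, get the multipliability of the Satake
Euler product off `S'`, and multiply by the finitely many factors at `v ∈ S'`.
[cite: JacquetShalikaAJM1981, Thm. (5.3), Lemma (5.2), Remark (5.4)] -/
theorem StandardLFunctionData.multipliable_L_of_lemma52 {P : CuspidalAutomorphicRepGL n K μ}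
    (h₁ : norm_satakeParameter_le_sqrt (μ := μ))
    (h₅₂ : JacquetShalika1981_continuation_partialPairL_conj (μ := μ)) :
    StandardLFunctionData.multipliable_L (P := P) := by
  classical
  intro D s hs
  obtain ⟨S₀, hS₀⟩ := summable_normSq_trace_finset_of_lemma52 h₁ h₅₂ P
  set S' : Finset (HeightOneSpectrum (𝓞 K)) := D.S ∪ S₀ with hS'
  have hsub : (↑D.S : Set (HeightOneSpectrum (𝓞 K))) ⊆ ↑S' := by
    rw [hS', Finset.coe_union]
    exact Set.subset_union_left
  have hα' : IsSatakeFamilyOf P ↑S' D.α := D.isSatakeFamily.mono hsub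
  have hsum := hS₀ Finset.subset_union_right hα' hs
  have hmul := multipliable_inv_eulerFactor (n := n) (fun v hv a ha => h₁ P hα' hv ha)
    (fun v hv => (hα'.card_eq hv).le) hs hsum
  refine Multipliable.mul_compl (s := (↑S' : Set (HeightOneSpectrum (𝓞 K)))) (S'.multipliable _) ?_
  refine hmul.congr fun v => ?_
  have hv : v.1 ∉ D.S := fun h => v.2 (hsub (Finset.mem_coe.mpr h))
  simp only [Function.comp_apply, D.localFactor_of_not_mem v.1 hv]

/-- Hence also `multipliable_partialStandardL`, `absolutelyConvergent_partialStandardL` and the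
other consequences of (5.3.3) recorded in `AutomorphicLFunctionProofs`, from Lemma (5.2), (5.1.3)
and the finiteness of ramification. [folklore] -/
theorem multipliable_partialStandardL_of_lemma52 (h₁ : norm_satakeParameter_le_sqrt (μ := μ))
    (h₅₂ : JacquetShalika1981_continuation_partialPairL_conj (μ := μ))
    (hfl : eventually_cofinite_isUnramifiedAt (μ := μ)) :
    multipliable_partialStandardL (μ := μ) :=
  multipliable_partialStandardL_of_summable (summable_normSq_trace_satakePow_of_lemma52 h₁ h₅₂ hfl)

end Cuspidal

/-! ### Theorem (5.3) for pairs from (5.3.3) for `π` and `π'` -/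

section Pairs

variable {K : Type} [Field K] [NumberField K]

/-- `‖q^{-s}‖^{k+1} / (k+1) = 1 / ((k+1) q^{(k+1) re s})`. [folklore] -/
theorem norm_natCast_cpow_neg_pow_div {q : ℕ} (hq : 0 < q) (s : ℂ) (k : ℕ) :
    ‖(q : ℂ) ^ (-s)‖ ^ (k + 1) / (k + 1) = 1 / ((k + 1 : ℝ) * (q : ℝ) ^ ((k + 1 : ℝ) * s.re)) := by
  have hq0 : (0 : ℝ) < q := by exact_mod_cast hq
  rw [norm_natCast_cpow_of_pos hq, neg_re, ← Real.rpow_mul_natCast hq0.le,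
    show -s.re * ((k + 1 : ℕ) : ℝ) = -((k + 1 : ℝ) * s.re) by push_cast; ring,
    Real.rpow_neg hq0.le]
  field_simp

/-- **Cauchy–Schwarz, (5.3.5)**: `‖a b x^{k+1} / (k+1)‖ ≤ (|a|² + |b|²) / ((k+1) q^{(k+1) re s})` for
`x = q^{-s}` (from `|a b| ≤ |a|² + |b|²`). [folklore] -/
theorem norm_mul_mul_cpow_pow_div_le (a b : ℂ) {q : ℕ} (hq : 0 < q) (s : ℂ) (k : ℕ) :
    ‖a * b * ((q : ℂ) ^ (-s)) ^ (k + 1) / (k + 1)‖ ≤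
      ‖a‖ ^ 2 / ((k + 1 : ℝ) * (q : ℝ) ^ ((k + 1 : ℝ) * s.re)) +
        ‖b‖ ^ 2 / ((k + 1 : ℝ) * (q : ℝ) ^ ((k + 1 : ℝ) * s.re)) := by
  have hw := norm_natCast_cpow_neg_pow_div hq s k
  have hD : (0 : ℝ) < (k + 1 : ℝ) * (q : ℝ) ^ ((k + 1 : ℝ) * s.re) := by positivity
  have hnorm : ‖a * b * ((q : ℂ) ^ (-s)) ^ (k + 1) / (k + 1)‖ =
      ‖a‖ * ‖b‖ * (1 / ((k + 1 : ℝ) * (q : ℝ) ^ ((k + 1 : ℝ) * s.re))) := by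
    rw [← hw, norm_div, norm_mul, norm_mul, norm_pow, ← Nat.cast_succ, Complex.norm_natCast,
      Nat.cast_succ, mul_div_assoc]
  rw [hnorm, ← add_div, div_eq_mul_one_div (‖a‖ ^ 2 + ‖b‖ ^ 2)]
  refine mul_le_mul_of_nonneg_right ?_ (by positivity)
  nlinarith [two_mul_le_add_sq ‖a‖ ‖b‖, mul_nonneg (norm_nonneg a) (norm_nonneg b)]

/-- The term `(k, v)` of the double series (5) of Jacquet–Shalika (1981), p. 556:
`tr A_v^{k+1} · tr B_v^{k+1} · q_v^{-(k+1)s} / (k + 1)` for two Satake families. [folklore] -/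
def pairLogTerm (S : Set (HeightOneSpectrum (𝓞 K))) (α β : SatakeFamily K) (s : ℂ)
    (i : ℕ × {v : HeightOneSpectrum (𝓞 K) // v ∉ S}) : ℂ :=
  ((α i.2.1).map (· ^ (i.1 + 1))).sum * ((β i.2.1).map (· ^ (i.1 + 1))).sum *
    ((i.2.1.residueCard : ℂ) ^ (-s)) ^ (i.1 + 1) / (i.1 + 1)

/-- **Jacquet–Shalika's Thm. (5.3) for pairs, analytic core** (loc. cit. p. 556, (2) and (5)):
for Satake families `α`, `β` satisfying the bound (5.1.3) off `S` and such that the series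
(5.3.3) `∑_{v ∉ S} ∑_k |tr A_v^k|² / (k q_v^{kσ})` and its analogue for `β` converge at
`σ = re s > 1`, the Euler product `∏_{v ∉ S} det(1 - q_v^{-s} A_v ⊗ B_v)⁻¹` converges: by
Cauchy–Schwarz (`|tr A_v^k tr B_v^k| ≤ |tr A_v^k|² + |tr B_v^k|²`, (5.3.5)) the double series
`∑_v ∑_k tr A_v^k tr B_v^k q_v^{-ks} / k` ((5)) converges absolutely, its sum over `k` is
`log L(s, π_v × π'_v)` ((1)), and the exponential of a convergent sum is a convergent product
((2)). [folklore] -/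
theorem multipliable_inv_satakePairPolynomial {S : Set (HeightOneSpectrum (𝓞 K))}
    {α β : SatakeFamily K}
    (hbα : ∀ v ∉ S, ∀ a ∈ α v, ‖a‖ ≤ Real.sqrt v.residueCard)
    (hbβ : ∀ v ∉ S, ∀ b ∈ β v, ‖b‖ ≤ Real.sqrt v.residueCard) {s : ℂ} (hs : 1 < s.re)
    (hA : Summable fun kv : ℕ × {v : HeightOneSpectrum (𝓞 K) // v ∉ S} =>
      ‖((α kv.2.1).map (· ^ (kv.1 + 1))).sum‖ ^ 2 /
        ((kv.1 + 1 : ℝ) * (kv.2.1.residueCard : ℝ) ^ ((kv.1 + 1 : ℝ) * s.re)))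
    (hB : Summable fun kv : ℕ × {v : HeightOneSpectrum (𝓞 K) // v ∉ S} =>
      ‖((β kv.2.1).map (· ^ (kv.1 + 1))).sum‖ ^ 2 /
        ((kv.1 + 1 : ℝ) * (kv.2.1.residueCard : ℝ) ^ ((kv.1 + 1 : ℝ) * s.re))) :
    Multipliable fun v : {v : HeightOneSpectrum (𝓞 K) // v ∉ S} =>
      ((satakePairPolynomial (α v.1) (β v.1)).eval ((v.1.residueCard : ℂ) ^ (-s)))⁻¹ := by
  have hx : ∀ v : {v : HeightOneSpectrum (𝓞 K) // v ∉ S},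
      Real.sqrt v.1.residueCard * Real.sqrt v.1.residueCard * ‖(v.1.residueCard : ℂ) ^ (-s)‖ < 1 := by
    intro v
    have hq1 : (1 : ℝ) < v.1.residueCard := by exact_mod_cast v.1.one_lt_residueCard
    have hq0 : (0 : ℝ) < v.1.residueCard := zero_lt_one.trans hq1
    rw [Real.mul_self_sqrt hq0.le, norm_natCast_cpow_of_pos (zero_lt_one.trans
      v.1.one_lt_residueCard), neg_re]
    calc (v.1.residueCard : ℝ) * (v.1.residueCard : ℝ) ^ (-s.re)
          = (v.1.residueCard : ℝ) ^ (1 + -s.re) := by rw [Real.rpow_add hq0, Real.rpow_one]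
      _ < 1 := Real.rpow_lt_one_of_one_lt_of_neg hq1 (by linarith)
  -- the double series (5), over `ℕ × {v ∉ S}`, converges absolutely by Cauchy–Schwarz
  have hT : Summable (pairLogTerm S α β s) :=
    Summable.of_norm_bounded (hA.add hB) fun kv =>
      norm_mul_mul_cpow_pow_div_le _ _ (zero_lt_one.trans kv.2.1.one_lt_residueCard) s kv.1
  obtain ⟨L, hL⟩ := hT
  -- sum first over `k` ((1): `log L(s, π_v × π'_v)`), then over `v`
  have hfib : ∀ v : {v : HeightOneSpectrum (𝓞 K) // v ∉ S},
      HasSum (fun k : ℕ => pairLogTerm S α β s (k, v))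
        (-((satakeTensor (α v.1) (β v.1)).map fun c =>
          Complex.log (1 - c * ((v.1.residueCard : ℂ) ^ (-s)))).sum) := fun v =>
    (hasSum_powerSum_mul_powerSum_mul_pow_div (hbα v.1 v.2) (hbβ v.1 v.2) (hx v)).congr_fun
      fun k => by simp only [pairLogTerm]
  have hG := HasSum.prod_fiberwise
    ((Equiv.prodComm {v : HeightOneSpectrum (𝓞 K) // v ∉ S} ℕ).hasSum_iff.mpr hL) hfib
  -- exponentiate ((2))
  refine hG.cexp.multipliable.congr fun v => ?_
  simp only [Function.comp_apply]
  exact exp_neg_sum_log_eq_inv_eval_satakePairPolynomial (hbα v.1 v.2) (hbβ v.1 v.2) (hx v)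

variable {n m : ℕ} {μ : Measure (AdelicGroupData.gl n K).automorphicQuotient}
  [(AdelicGroupData.gl n K).IsAutomorphicMeasure μ]
  {μ' : Measure (AdelicGroupData.gl m K).automorphicQuotient}
  [(AdelicGroupData.gl m K).IsAutomorphicMeasure μ']

/-- **Jacquet–Shalika's Thm. (5.3) for pairs from (5.3.3)–(5.3.4).** The named fact
`JacquetShalika1981_multipliable_partialPairL` of `PairLFunctionBaseChange` (the Euler product
`L^S(s, π × π') = ∏_{v ∉ S} det(1 - q_v^{-s} A_v ⊗ A'_v)⁻¹` of two cuspidal representations is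
multipliable on `re s > 1`) follows from the convergence (5.3.3)–(5.3.4) of
`∑_v ∑_k |tr A_v^k|² / (k q_v^{kσ})` for `π` and for `π'` (`summable_normSq_trace_satakePow` at
`GL_n` and at `GL_m`) — the printed proof, p. 556: Cauchy–Schwarz (5.3.5) and (2); the bound
(5.1.3) it uses is itself a consequence (`norm_satakeParameter_le_sqrt_of_summable`).
[cite: JacquetShalikaAJM1981, Thm. (5.3)] -/
theorem JacquetShalika1981_multipliable_partialPairL_of_summable
    (h₂ : summable_normSq_trace_satakePow (μ := μ))
    (h₂' : summable_normSq_trace_satakePow (μ := μ')) :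
    JacquetShalika1981_multipliable_partialPairL (n := n) (m := m) (K := K) (μ := μ) (μ' := μ') := by
  intro P P' S α β hα hβ s hs
  exact multipliable_inv_satakePairPolynomial
    (fun v hv a ha => norm_satakeParameter_le_sqrt_of_summable h₂ P hα hv ha)
    (fun v hv b hb => norm_satakeParameter_le_sqrt_of_summable h₂' P' hβ hv hb) hs
    (h₂ P hα hs) (h₂' P' hβ hs)

/-- Hence **Thm. (5.3) for pairs from Lemma (5.2), (5.1.3) and the finiteness of ramification**
(at `GL_n` and at `GL_m`). [cite: JacquetShalikaAJM1981, Thm. (5.3), Lemma (5.2)] -/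
theorem JacquetShalika1981_multipliable_partialPairL_of_lemma52
    (h₁ : norm_satakeParameter_le_sqrt (μ := μ))
    (h₅₂ : JacquetShalika1981_continuation_partialPairL_conj (μ := μ))
    (hfl : eventually_cofinite_isUnramifiedAt (μ := μ))
    (h₁' : norm_satakeParameter_le_sqrt (μ := μ'))
    (h₅₂' : JacquetShalika1981_continuation_partialPairL_conj (μ := μ'))
    (hfl' : eventually_cofinite_isUnramifiedAt (μ := μ')) :
    JacquetShalika1981_multipliable_partialPairL (n := n) (m := m) (K := K) (μ := μ) (μ' := μ') :=
  JacquetShalika1981_multipliable_partialPairL_of_summable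
    (summable_normSq_trace_satakePow_of_lemma52 h₁ h₅₂ hfl)
    (summable_normSq_trace_satakePow_of_lemma52 h₁' h₅₂' hfl')

end Pairs

end Literature.NumberTheory.Automorphic
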